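import Literature.AnabelianGeometry.EtaleTheta.ConstantsDictionary
import Mathlib.RingTheory.IntegralDomain
import Mathlib.RingTheory.RootsOfUnity.Basic
import Mathlib.GroupTheory.SpecificGroups.Cyclic
import Mathlib.Data.ZMod.Basic

/-!
# [EtTh] Definition 5.4: the two clauses of `(l, N)`-theta-saturation from an EMBEDDING OF THE UNITS INTO A FIELD and a CYCLIC
# theta subquotient — generic over every §5 datum; at the junction, clause (a) for `B_N` from the constants dictionary

Mochizuki, *The étale theta function and its Frobenioid-theoretic manifestations*, Publ. RIMS **45** (2009), Def. 5.4 p.327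
(PDF p.101): «We shall say that `S ∈ Ob(C)` is `(l, N)`-theta-saturated if the following conditions are satisfied: (a) `S` is
`μ_{l·N}`-saturated [cf. [Mzk18], Definition 2.1, (i)]; (b) `(l·Δ_Θ)_S ⊗ ℤ/Nℤ` is of cardinality `N`.»
[cite: MochizukiEtTh2009, Def 5.4 p.327 (PDF p.101)]; [FrdII] = Mochizuki, *The geometry of Frobenioids II*, Kyushu J. Math. **62**
(2008), Def. 2.1 (i) p.16 («`A` is `μ_N`-saturated if the abstract group `μ_N(A)` is isomorphic to `ℤ/Nℤ`»)
[cite: MochizukiFrdII2008, Def. 2.1 (i) p.16]; Lemma 5.8 p.331 (PDF p.105) (the constants `(K^×)^{1/N} ⊆ O^×(B_N^birat)`, `μ_N(B_N)`).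

abc-iut cell, layer L2, seat abc-iut-L2-t4 (gen 9; typer of record of Def. 5.4, `FrobenioidTheta.lean` p404948), row «DEF54-INSTANCE@MODEL»
(abc-iut-L2-lead R1125).  PROOF-ONLY: no definition, no new `Prop`, no instance, no notation; nothing landed is edited or restated.
Consumed BY NAME: abc-iut-L2-t4's `ThetaFrobenioid.IsMuSaturated` / `muTorsion` / `IsThetaSaturated` / `lDeltaModN` and abc-iut-L2-t11's
predicate `ThetaFrobenioid.BiratAutAction.ConstantsDictionary` (`ConstantsDictionary.lean`); Mathlib's «a finite subgroup of the units of an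
integral domain is cyclic» (`isCyclic_of_injective_ringHom`) and `mulEquivOfCyclicCardEq`.

WHAT IS PROVED (every §5 datum `𝔉 : ThetaFrobenioid C D`, every object `S`).
* `ThetaFrobenioid.isMuSaturated_of_units_embedding` — **clause (a) from an embedding of the units into a field**: if `O^×(S)` embeds, as a
  group, into the multiplicative monoid of an integral domain `F` (the constant field read in `ℚ̄_p`, Lemma 5.8), and `O^×(S)` contains ONE
  element of order `M ≥ 1` (a primitive `M`-th root of unity), then `μ_M(S) ≃ ℤ/Mℤ`: `μ_M(S)` is a finite subgroup of `Fˣ` (inside the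
  `M`-th roots of unity), hence cyclic, of exponent dividing `M` and containing an element of order `M`, hence of order exactly `M`.
* `ThetaFrobenioid.card_lDeltaModN_of_mulEquiv` — **clause (b) from any identification** of `(l·Δ_Θ)_S ⊗ ℤ/Nℤ` with a group of
  cardinality `N` (at the junction: the Prop. 5.5 binders `ν : (l·Δ_Θ)_{B_N} ⊗ ℤ/N ≃ μ_N(B_N)`, `m : μ_N(B_N) ≃ μ_N`).
* `ThetaFrobenioid.isThetaSaturated_of_units_embedding` — Def. 5.4 from the two.
* **`ThetaFrobenioid.BiratAutAction.ConstantsDictionary.isMuSaturated_BN`** — AT ANY §5 DATUM CARRYING abc-iut-L2-t11's CONSTANTS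
  DICTIONARY `hD` (the displayed class-(c) input of the Lemma 5.8 / Thm. 5.10 closers of record: `O^×(B_N) ⊆ Cst`, injective reading
  `ν̃ : Cst ↪ ℚ̄_p^×`): **`B_N` is `μ_{l·N}`-saturated as soon as `O^×(B_N)` contains an element of order `l·N`** (print: `B_N` lives over
  `Ÿ_{l·N}`, whose constants contain `μ_{l·N}`); and `…isThetaSaturated_BN` — `B_N` is `(l, N)`-theta-saturated given moreover any
  identification of `(l·Δ_Θ)_{B_N} ⊗ ℤ/N` with a group of cardinality `N`.
NET for the binder lists of the Prop. 5.5 / Thm. 5.6 closers at the genuine junction (`ofConnectedTemperoidData`, its `Ÿ̲̲`/ThetaSetting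
twins): the displayed `hB : IsThetaSaturated B_N` splits into {`hD` (shared with Lemma 5.8 / Thm. 5.10), `hζ` (one unit of order `l·N`),
`hΔ` (cardinality of the cyclotome quotient — supplied by the closers' own `ν`, `m`)}.
HONEST FRAMING: group theory over the typed §5 record; no carrier of record is claimed to instantiate Def. 5.4 here (no §5 datum exists yet
over a tempered Frobenioid of record — cell rows R1112/R1114); nothing asserts such data exist for an actual curve; [EtTh] is a refereed
paper and nothing here bears on [IUTchIII] Cor. 3.12 — no side taken; typed ≠ proved except the theorems below.
-/

namespace Literature.AnabelianGeometry.EtaleTheta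

open CategoryTheory

universe w v v' u u'

namespace ThetaFrobenioid

variable {C : Type u} [Category.{v} C] {D : Type u'} [Category.{v'} D] (𝔉 : ThetaFrobenioid.{w} C D)

/-! ### Clause (a): `μ_M(S) ≃ ℤ/Mℤ` from an embedding of `O^×(S)` into a field -/

/-- `Nat.card (Multiplicative (ZMod M)) = M`. [folklore] -/
private theorem natCard_multiplicative_zmod (M : ℕ) : Nat.card (Multiplicative (ZMod M)) = M := by
  show Nat.card (ZMod M) = M
  exact Nat.card_zmod M

/-- **`μ_M(S)` is finite and cyclic whenever `O^×(S)` embeds into an integral domain** ([FrdII] Def. 2.1 (i) context: `μ_M(S)` is then a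
finite subgroup — inside the `M`-th roots of unity — of the units of a field; `M ≥ 1`).
[cite: MochizukiEtTh2009, Def 5.4 p.327 (PDF p.101)] [cite: MochizukiFrdII2008, Def. 2.1 (i) p.16] -/
theorem muTorsion_finite_of_units_embedding {F : Type*} [CommRing F] [IsDomain F] (S : C) {M : ℕ} (hM : 0 < M)
    (ι : 𝔉.units S →* F) (hι : Function.Injective ι) : Finite (𝔉.muTorsion S M) := by
  classical
  haveI : NeZero M := ⟨hM.ne'⟩
  -- `μ_M(S) → μ_M(F)`, `u ↦ ι(u)`, is injective
  let j : 𝔉.muTorsion S M →* 𝔉.units S := Subgroup.inclusion (𝔉.muTorsion_le_units S M)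
  have hj : Function.Injective j := Subgroup.inclusion_injective _
  let r : 𝔉.muTorsion S M → rootsOfUnity M F := fun u =>
    ⟨(ι.comp j).toHomUnits u, by
      rw [mem_rootsOfUnity, ← map_pow]
      have hu : u ^ M = 1 := Subtype.ext (by
        rw [Subgroup.coe_pow, Subgroup.coe_one]; exact (𝔉.mem_muTorsion.mp u.2).2)
      rw [hu, map_one]⟩
  refine Finite.of_injective r fun a b hab => ?_
  have h1 : (ι.comp j) a = (ι.comp j) b := by
    have := congrArg (fun x : rootsOfUnity M F => ((x : Fˣ) : F)) hab
    simpa [r] using this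
  exact hj (hι h1)

/-- **[EtTh] Def. 5.4 (a) / [FrdII] Def. 2.1 (i) from an embedding of the units into a field**: if `O^×(S)` embeds (as a group) into the
multiplicative monoid of an integral domain `F` and contains an element of order `M ≥ 1`, then `S` is `μ_M`-saturated, `μ_M(S) ≃ ℤ/Mℤ` —
a finite subgroup of the units of an integral domain is cyclic; its exponent divides `M` and is divisible by `M`.
[cite: MochizukiEtTh2009, Def 5.4 p.327 (PDF p.101)] [cite: MochizukiFrdII2008, Def. 2.1 (i) p.16] -/
theorem isMuSaturated_of_units_embedding {F : Type*} [CommRing F] [IsDomain F] (S : C) {M : ℕ} (hM : 0 < M)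
    (ι : 𝔉.units S →* F) (hι : Function.Injective ι) (hζ : ∃ u ∈ 𝔉.units S, orderOf u = M) :
    𝔉.IsMuSaturated S M := by
  classical
  haveI : Finite (𝔉.muTorsion S M) := 𝔉.muTorsion_finite_of_units_embedding S hM ι hι
  let j : 𝔉.muTorsion S M →* 𝔉.units S := Subgroup.inclusion (𝔉.muTorsion_le_units S M)
  have hj : Function.Injective j := Subgroup.inclusion_injective _
  haveI : IsCyclic (𝔉.muTorsion S M) := isCyclic_of_injective_ringHom (ι.comp j) (hι.comp hj)
  -- the cardinality of `μ_M(S)` is `M`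
  obtain ⟨u, hu, hord⟩ := hζ
  have huM : u ∈ 𝔉.muTorsion S M := ⟨hu, by rw [← hord]; exact pow_orderOf_eq_one u⟩
  have hcard : Nat.card (𝔉.muTorsion S M) = M := by
    apply Nat.dvd_antisymm
    · rw [← IsCyclic.exponent_eq_card, Monoid.exponent_dvd_iff_forall_pow_eq_one]
      intro g
      exact Subtype.ext (by rw [Subgroup.coe_pow, Subgroup.coe_one]; exact (𝔉.mem_muTorsion.mp g.2).2)
    · have h1 : orderOf (⟨u, huM⟩ : 𝔉.muTorsion S M) = M :=
        (orderOf_injective (𝔉.muTorsion S M).subtype Subtype.coe_injective ⟨u, huM⟩).symm.trans hord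
      have h2 := orderOf_dvd_natCard (⟨u, huM⟩ : 𝔉.muTorsion S M)
      rwa [h1] at h2
  exact ⟨mulEquivOfCyclicCardEq (by rw [hcard, natCard_multiplicative_zmod])⟩

/-- From a unit of order `l·N`, a unit of order `N`: its `l`-th power (`μ_N(S) = l·μ_{l·N}(S)`, Prop. 5.5 p.327 (PDF p.101)).
[cite: MochizukiEtTh2009, Prop 5.5 p.327 (PDF p.101)] -/
theorem exists_units_orderOf_eq_N (S : C) (hζ : ∃ u ∈ 𝔉.units S, orderOf u = 𝔉.l * (𝔉.N : ℕ)) :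
    ∃ u ∈ 𝔉.units S, orderOf u = (𝔉.N : ℕ) := by
  obtain ⟨u, hu, hord⟩ := hζ
  refine ⟨u ^ 𝔉.l, Subgroup.pow_mem _ hu _, ?_⟩
  rw [orderOf_pow' u 𝔉.odd_l.pos.ne', hord, Nat.gcd_mul_right_left, Nat.mul_div_cancel_left _ 𝔉.odd_l.pos]

/-! ### Clause (b): the cardinality of `(l·Δ_Θ)_S ⊗ ℤ/Nℤ` from an identification -/

/-- **[EtTh] Def. 5.4 (b) from any identification** of `(l·Δ_Θ)_S ⊗ ℤ/Nℤ` with a group of cardinality `N` (at the junction the Prop. 5.5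
closers carry `ν : (l·Δ_Θ)_{B_N} ⊗ ℤ/N ≃ μ_N(B_N)` and `m : μ_N(B_N) ≃ μ_N`). [cite: MochizukiEtTh2009, Def 5.4 p.327 (PDF p.101)] -/
theorem card_lDeltaModN_of_mulEquiv (S : C) {G : Type*} [Group G] (e : 𝔉.lDeltaModN S ≃* G) (hG : Nat.card G = 𝔉.N) :
    Nat.card (𝔉.lDeltaModN S) = 𝔉.N := by
  rw [Nat.card_congr e.toEquiv, hG]

/-- Clause (b) from an identification with `ℤ/Nℤ` itself («of cardinality `N`»). [cite: MochizukiEtTh2009, Def 5.4 p.327 (PDF p.101)] -/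
theorem card_lDeltaModN_of_mulEquiv_zmod (S : C) (e : 𝔉.lDeltaModN S ≃* Multiplicative (ZMod 𝔉.N)) :
    Nat.card (𝔉.lDeltaModN S) = 𝔉.N :=
  𝔉.card_lDeltaModN_of_mulEquiv S e (natCard_multiplicative_zmod _)

/-- Clause (b) from an identification with `μ_N(S)` of a `μ_N`-saturated `S` (the shape of Prop. 5.5: `(l·Δ_Θ)_S ⊗ ℤ/Nℤ ⥲ μ_N(S)`).
[cite: MochizukiEtTh2009, Def 5.4 p.327 (PDF p.101); Prop 5.5 p.327 (PDF p.101)] -/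
theorem card_lDeltaModN_of_mulEquiv_muTorsion (S : C) (ν : 𝔉.lDeltaModN S ≃* 𝔉.muTorsion S 𝔉.N)
    (hμ : 𝔉.IsMuSaturated S 𝔉.N) : Nat.card (𝔉.lDeltaModN S) = 𝔉.N := by
  obtain ⟨e⟩ := hμ
  exact 𝔉.card_lDeltaModN_of_mulEquiv_zmod S (ν.trans e)

/-- **Clause (b) when `(l·Δ_Θ)_S` is finite of cardinality `N`** (print's situation at an `l·N`-codomain: the image of `l·Δ_Θ` in
`Aut^Θ(S^bs)` is cyclic of order `N`): every `N`-th power is then trivial, so `(l·Δ_Θ)_S ⊗ ℤ/Nℤ = (l·Δ_Θ)_S` has cardinality `N`.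
[cite: MochizukiEtTh2009, Def 5.4 p.327 (PDF p.101)] -/
theorem card_lDeltaModN_of_card_lDeltaObj (S : C) [Finite (𝔉.lDeltaObj S)] (h : Nat.card (𝔉.lDeltaObj S) = 𝔉.N) :
    Nat.card (𝔉.lDeltaModN S) = 𝔉.N := by
  have hbot : (powMonoidHom (𝔉.N : ℕ) : 𝔉.lDeltaObj S →* 𝔉.lDeltaObj S).range = ⊥ := by
    rw [eq_bot_iff]
    rintro _ ⟨x, rfl⟩
    rw [Subgroup.mem_bot, powMonoidHom_apply, ← h]
    exact orderOf_dvd_iff_pow_eq_one.mp (orderOf_dvd_natCard x)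
  have hH : Nat.card ((powMonoidHom (𝔉.N : ℕ) : 𝔉.lDeltaObj S →* 𝔉.lDeltaObj S).range) = 1 := by
    rw [hbot, Subgroup.card_bot]
  have hq := Subgroup.card_eq_card_quotient_mul_card_subgroup
    ((powMonoidHom (𝔉.N : ℕ) : 𝔉.lDeltaObj S →* 𝔉.lDeltaObj S).range)
  rw [hH, mul_one, h] at hq
  exact hq.symm

/-- **Clause (b) from `(l·Δ_Θ)_S ≃ ℤ/Nℤ`** (the cyclotome of an `l·N`-codomain). [cite: MochizukiEtTh2009, Def 5.4 p.327 (PDF p.101)] -/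
theorem card_lDeltaModN_of_lDeltaObj_mulEquiv_zmod (S : C) (e : 𝔉.lDeltaObj S ≃* Multiplicative (ZMod 𝔉.N)) :
    Nat.card (𝔉.lDeltaModN S) = 𝔉.N := by
  haveI : NeZero (𝔉.N : ℕ) := ⟨𝔉.N.ne_zero⟩
  haveI : Finite (𝔉.lDeltaObj S) := Finite.of_equiv _ e.symm.toEquiv
  exact 𝔉.card_lDeltaModN_of_card_lDeltaObj S (by rw [Nat.card_congr e.toEquiv, natCard_multiplicative_zmod])

/-! ### Definition 5.4 from the two clauses -/

/-- **[EtTh] Def. 5.4 from an embedding of `O^×(S)` into a field, one unit of order `l·N`, and an identification of `(l·Δ_Θ)_S ⊗ ℤ/Nℤ`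
with a group of cardinality `N`.** [cite: MochizukiEtTh2009, Def 5.4 p.327 (PDF p.101)] -/
theorem isThetaSaturated_of_units_embedding {F : Type*} [CommRing F] [IsDomain F] (S : C)
    (ι : 𝔉.units S →* F) (hι : Function.Injective ι) (hζ : ∃ u ∈ 𝔉.units S, orderOf u = 𝔉.l * (𝔉.N : ℕ))
    {G : Type*} [Group G] (e : 𝔉.lDeltaModN S ≃* G) (hG : Nat.card G = 𝔉.N) : 𝔉.IsThetaSaturated S where
  muSaturated := 𝔉.isMuSaturated_of_units_embedding S (Nat.mul_pos 𝔉.odd_l.pos 𝔉.N.pos) ι hι hζ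
  card_lDeltaModN := 𝔉.card_lDeltaModN_of_mulEquiv S e hG

end ThetaFrobenioid

/-! ### At any §5 datum carrying the constants dictionary: clause (a) for `B_N` -/

namespace ThetaFrobenioid.BiratAutAction.ConstantsDictionary

variable {C₀ : Type u} [Category.{0} C₀] {D₀ : Type u'} [Category.{v'} D₀] {𝔉 : ThetaFrobenioid.{w} C₀ D₀}
  {α : 𝔉.BiratAutAction} {p : ℕ} [Fact p.Prime] {Dθ : ThetaSetting p} {E : Dθ.EtaleThetaData} {l : ℕ}
  {Cu : E.DoubleUnderline l} {μ : Dθ.CyclotomeMod l 𝔉.N} {hC : Dθ.Compat} {hS : Dθ.Sec2Hyps}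
  {ι : 𝔉.PiX ≃ₜ* (Cu.thetaEnvData μ hC hS).PiX} {m : 𝔉.muTorsion 𝔉.BN 𝔉.N ≃* (Cu.thetaEnvData μ hC hS).mu}
  {Cst : Subgroup (𝔉.biratUnits 𝔉.BN)} {ν' : Cst →* (PadicAlgCl p)ˣ}
  (hD : ConstantsDictionary α Cu μ hC hS ι m Cst ν')

include hD

/-- **The units of `B_N` read in `ℚ̄_p`**: `O^×(B_N) ↪ O^×(B_N^birat)` (the natural inclusion) lands in the constants `Cst` (`hD.units_mem`,
Prop. 3.4 (ii): a unit is a constant), which the dictionary reads injectively into `ℚ̄_p^×` — an injective group homomorphism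
`O^×(B_N) →* ℚ̄_p`. [cite: MochizukiEtTh2009, Lem 5.8 p.331 (PDF p.105); Def 3.6 (iv) p.304 (PDF p.78)] -/
theorem exists_units_embedding :
    ∃ j : 𝔉.units 𝔉.BN →* PadicAlgCl p, Function.Injective j := by
  let c : 𝔉.units 𝔉.BN →* Cst :=
    { toFun := fun u => ⟨𝔉.unitsToBirat 𝔉.BN u, hD.units_mem u⟩
      map_one' := Subtype.ext (by simp)
      map_mul' := fun a b => Subtype.ext (by simp) }
  have hc : Function.Injective c := fun a b hab =>
    𝔉.unitsToBirat_injective 𝔉.BN (congrArg (fun x : Cst => (x : 𝔉.biratUnits 𝔉.BN)) hab)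
  refine ⟨((Units.coeHom (PadicAlgCl p)).comp ν').comp c, ?_⟩
  exact (Units.val_injective.comp hD.injective).comp hc

/-- **[EtTh] Def. 5.4 (a) for `B_N` at any §5 datum carrying the constants dictionary**: `B_N` is `μ_{l·N}`-saturated as soon as
`O^×(B_N)` contains an element of order `l·N` (print: `B_N` is the `l·N`-codomain over `Ÿ_{l·N}`, whose constant field contains `μ_{l·N}`;
`μ_{l·N}(B_N)` embeds into `ℚ̄_p^×` through the dictionary, hence is cyclic of order exactly `l·N`).
[cite: MochizukiEtTh2009, Def 5.4 p.327 (PDF p.101); Lem 5.8 p.331 (PDF p.105)] -/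
theorem isMuSaturated_BN (hζ : ∃ u ∈ 𝔉.units 𝔉.BN, orderOf u = 𝔉.l * (𝔉.N : ℕ)) :
    𝔉.IsMuSaturated 𝔉.BN (𝔉.l * (𝔉.N : ℕ)) := by
  obtain ⟨j, hj⟩ := hD.exists_units_embedding
  exact 𝔉.isMuSaturated_of_units_embedding 𝔉.BN (Nat.mul_pos 𝔉.odd_l.pos 𝔉.N.pos) j hj hζ

/-- The same at an arbitrary level `M ≥ 1`: `B_N` is `μ_M`-saturated as soon as `O^×(B_N)` contains an element of order `M`.
[cite: MochizukiEtTh2009, Def 5.4 p.327 (PDF p.101); Lem 5.8 p.331 (PDF p.105)] -/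
theorem isMuSaturated_BN_of_orderOf {M : ℕ} (hM : 0 < M) (hζ : ∃ u ∈ 𝔉.units 𝔉.BN, orderOf u = M) :
    𝔉.IsMuSaturated 𝔉.BN M := by
  obtain ⟨j, hj⟩ := hD.exists_units_embedding
  exact 𝔉.isMuSaturated_of_units_embedding 𝔉.BN hM j hj hζ

/-- Hence also `B_N` is `μ_N`-saturated (the `l`-th power of a unit of order `l·N` has order `N`).
[cite: MochizukiEtTh2009, Def 5.4 p.327 (PDF p.101); Prop 5.5 p.327 (PDF p.101)] -/
theorem isMuSaturated_BN_N (hζ : ∃ u ∈ 𝔉.units 𝔉.BN, orderOf u = 𝔉.l * (𝔉.N : ℕ)) : 𝔉.IsMuSaturated 𝔉.BN 𝔉.N :=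
  hD.isMuSaturated_BN_of_orderOf 𝔉.N.pos (𝔉.exists_units_orderOf_eq_N 𝔉.BN hζ)

/-- **[EtTh] Def. 5.4 for `B_N` from {the constants dictionary, one unit of order `l·N`, the Prop. 5.5 identification
`ν : (l·Δ_Θ)_{B_N} ⊗ ℤ/Nℤ ⥲ μ_N(B_N)`}** — `ν` is the binder the Prop. 5.5 closers of record at the junction already carry; so their displayed
`hB : IsThetaSaturated B_N` reduces to `hD` (shared with Lemma 5.8 / Thm. 5.10), `hζ` and `ν`.
[cite: MochizukiEtTh2009, Def 5.4 p.327 (PDF p.101); Prop 5.5 p.327 (PDF p.101)] -/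
theorem isThetaSaturated_BN_of_mulEquiv_muTorsion (hζ : ∃ u ∈ 𝔉.units 𝔉.BN, orderOf u = 𝔉.l * (𝔉.N : ℕ))
    (ν : 𝔉.lDeltaModN 𝔉.BN ≃* 𝔉.muTorsion 𝔉.BN 𝔉.N) : 𝔉.IsThetaSaturated 𝔉.BN where
  muSaturated := hD.isMuSaturated_BN hζ
  card_lDeltaModN := 𝔉.card_lDeltaModN_of_mulEquiv_muTorsion 𝔉.BN ν (hD.isMuSaturated_BN_N hζ)

/-- **[EtTh] Def. 5.4 for `B_N` at any §5 datum carrying the constants dictionary**, from one unit of order `l·N` and any identification of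
`(l·Δ_Θ)_{B_N} ⊗ ℤ/Nℤ` with a group of cardinality `N` (e.g. the Prop. 5.5 closers' `ν`, `m`).
[cite: MochizukiEtTh2009, Def 5.4 p.327 (PDF p.101)] -/
theorem isThetaSaturated_BN (hζ : ∃ u ∈ 𝔉.units 𝔉.BN, orderOf u = 𝔉.l * (𝔉.N : ℕ))
    {G : Type*} [Group G] (e : 𝔉.lDeltaModN 𝔉.BN ≃* G) (hG : Nat.card G = 𝔉.N) : 𝔉.IsThetaSaturated 𝔉.BN where
  muSaturated := hD.isMuSaturated_BN hζ
  card_lDeltaModN := 𝔉.card_lDeltaModN_of_mulEquiv 𝔉.BN e hG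

end ThetaFrobenioid.BiratAutAction.ConstantsDictionary

end Literature.AnabelianGeometry.EtaleTheta
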